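import Summits.CriticalPhenomena.PercolationContinuityZ3.Theorems.Transplant.FKConnectivityAllQAntipodalMinorGluing
import Summits.CriticalPhenomena.PercolationContinuityZ3.Theorems.Transplant.FKConnectivityAllQAntipodalUpc
import Summits.CriticalPhenomena.PercolationContinuityZ3.Theorems.Transplant.FKConnectivityAllQSPReroot
import HarnessLib

/-!
# Connectivity correlation inequalities for `φ_{w,q}`, every `q > 0` — file 22b: antipodal up-correlation WITH A CONTRACTED SET;
# ALL coefficients of `Z² Cov_{φ_{z,q}}(ω_x, g)` are signed on series–parallel graphs

Support file (`--supports stmt-CriticalPhenomena-4575`), FK sub-lane `prim-bschramm-fk-2` (gen 11) of the post-continuity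
programme; builds on p205010 (kernel theorem, internal audit signed; external expert review pending).  No definitions, no named
facts, no sorries; standard axioms.

COEFFICIENT DICTIONARY.  For a finite graph `H`, edge odds `z = (z_e)`, `0 < q`, and functions `f, g` of the configuration, group the double sum
`Z_H(z)² Cov_{φ_{z,q}}(f,g) = ½ ∑_{ω,ω'} z^ω z^{ω'} q^{k(ω)+k(ω')} (f(ω) − f(ω'))(g(ω) − g(ω'))` by `C = ω ∩ ω'` (open in both samples) and
`M = ω Δ ω'` (open in exactly one): the coefficient of the monomial `z^{2·1_C + 1_M}` is `½ · apPsiC q M C f g`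
(`…AntipodalMinorDefs.lean`: `ω = γ ∪ C`, `ω' = (M \ γ) ∪ C`, `γ ⊆ M`; contraction of `C` = union with `C` inside the cluster count, deletion of the
remaining edges = their absence).  So "`apPsiC q M C f g ≤ 0` for all disjoint `M, C ⊆ E(H)`" is exactly "every coefficient of
`Z_H² Cov_{φ_{z,q}}(f, g)` is `≤ 0`" — gen 10's Conjecture C_∞ ('Rayleigh for events') for the pair `(f, g)`.

THEOREMS.  `FK.apUpcC_nonneg_of_isTTSP`: for a two-terminal series–parallel network `E` between `s,t`, all `M, C ⊆ E`, every `q > 0` and every `h`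
monotone on the subsets of `M`, `0 ≤ apUpcC q M C s t h` (the induction of `…AntipodalUpc.lean`; a contracted terminal pair makes every term
vanish).  `FK.apPsiC_edge_eq`: `q · apPsiC q (M ∪ {st}) C 1_{st} g = 2(q−1) · apUpcC q M C s t (γ ↦ g(γ ∪ C))` for `st ∉ M ∪ C`, `g` not reading
`st`.  Hence **`FK.apPsiC_edge_nonpos_of_isTTSP`** (`0 < q ≤ 1`): for every series–parallel graph presented from an edge `x = st`
(`H = E ∪ {x}`, `E` TTSP between `s, t` — Duffin's form of every 2-connected series–parallel graph; sub-networks included), EVERY coefficient of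
`Z_H² Cov_{φ_{z,q}}(ω_x, g)` (`g` increasing, not reading `x`) is `≤ 0`: COEFFICIENTWISE SINGLE-EDGE NEGATIVE DEPENDENCE of the `q < 1`
random-cluster model on series–parallel graphs (the value at `z ≥ 0` is gen 8's `FK.edgeNegDep_of_isTTSP`; the property fails for `K₄`, where the
coefficient of `z_x z_y ∏_{e≠x,y} z_e` in `Z² Cov(ω_x, ω_y)`, `x, y` opposite, is `q²(1−q)(2−3q−q²) > 0` for `q < (√17−3)/2`); for `q ≥ 1` every
coefficient is `≥ 0` (`…_nonneg_of_one_le`); by linearity in the odd increment (`FK.apPsiC_two_edges_eq`) the same for `f = ω_x ω_y` and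
`f = ω_x ∨ ω_y` (`FK.apPsiC_two_edges_nonpos_of_isTTSP`).  Census context (this seat, kit j121498/j121499): the remaining levels of C_∞
(`|supp f|, |supp g| ≥ 3`) hold in 93·10⁶ exact/float cells on series–parallel graphs and fail on every tested `K₄`-minor graph.
[cite: Grimmett2006, §1.4 eq. (1.20) (p. 15); §3.8 Thm. (3.90) (pp. 61–62); §3.9 (pp. 63–64)] [cite: Wagner2006, Thm. 5.8(d), §5.3]
-/

noncomputable section

namespace Summit.CriticalPhenomena.PercolationContinuityZ3.Theorems

namespace FK

open SimpleGraph Literature.Probability.LatticeModels Literature.Probability.Percolation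
open scoped Classical

variable {V : Type*} [Fintype V]

/-! ### The single edge, and the theorem -/

section Main

variable {s t : V}

omit [Fintype V] in
/-- Without contracted edges the functional is that of `…AntipodalDefs.lean`. [folklore] -/
theorem apUpcC_empty_right (q : ℝ) (E : Finset (Sym2 V)) (s t : V) (h : Finset (Sym2 V) → ℝ) :
    apUpcC q E ∅ s t h = apUpc q E s t h := by
  unfold apUpcC apUpc apExpC apExp
  simp only [Finset.union_empty]

omit [Fintype V] in
/-- The functional of the empty free set vanishes. [folklore] -/
theorem apUpcC_empty (q : ℝ) (C : Finset (Sym2 V)) (s t : V) (h : Finset (Sym2 V) → ℝ) : apUpcC q ∅ C s t h = 0 := by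
  unfold apUpcC
  rw [Finset.powerset_empty, Finset.sum_singleton, sdiff_self, Finset.bot_eq_empty, sub_self, zero_mul, mul_zero]

omit [Fintype V] in
/-- If the terminal pair itself is contracted, both members of every pair join the terminals and the functional vanishes. [folklore] -/
theorem apUpcC_eq_zero_of_mem (q : ℝ) {E C : Finset (Sym2 V)} (hC : s(s, t) ∈ C) (hst : s ≠ t) (h : Finset (Sym2 V) → ℝ) :
    apUpcC q E C s t h = 0 := by
  unfold apUpcC
  refine Finset.sum_eq_zero fun γ _ => ?_
  have key : ∀ A : Finset (Sym2 V), apConn (A ∪ C) s t = 1 := fun A =>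
    apConn_of_reachable (Adj.reachable ((fromEdgeSet_adj _).2 ⟨by
      rw [Finset.coe_union]; exact Or.inr (Finset.mem_coe.2 hC), hst⟩))
  rw [key, key, sub_self, zero_mul, mul_zero]

/-- **THEOREM (antipodal up-correlation with a contracted set, every `q > 0`).**  If `E` is a two-terminal series–parallel network
between `s` and `t`, then for every free set `M ⊆ E`, every contracted set `C ⊆ E`, every `q > 0` and every test function `h` monotone on
the subsets of `M`: `0 ≤ apUpcC q M C s t h = ∑_{γ ⊆ M} q^{k(γ∪C)+k((M\γ)∪C)} (1{s↔t in γ∪C} - 1{s↔t in (M\γ)∪C}) h(γ)` — Theorem U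
(`FK.apUpc_nonneg_of_isTTSP`) for the MINOR `E / C \ (E \ (M ∪ C))`, stated without quotient types (contraction = union with `C` inside the
cluster count).  Same induction: the contracted edges ride along inside both members of every pair; a contracted terminal edge kills every term.
[cite: Grimmett2006, §3.8 Thm. (3.90) (pp. 61–62); §3.9 (pp. 63–64)] [cite: Wagner2006, Thm. 5.8(d), §5.3] -/
theorem apUpcC_nonneg_of_isTTSP {q : ℝ} (hq : 0 < q) {E : Finset (Sym2 V)} {s t : V} (hE : IsTTSP E s t) :
    ∀ M C : Finset (Sym2 V), M ⊆ E → C ⊆ E → ∀ h : Finset (Sym2 V) → ℝ,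
      (∀ ⦃A B : Finset (Sym2 V)⦄, A ⊆ B → B ⊆ M → h A ≤ h B) → 0 ≤ apUpcC q M C s t h := by
  induction hE with
  | @edge s t hst =>
    intro M C hM hC h hmono
    rcases Finset.subset_singleton_iff.1 hC with rfl | rfl
    · rw [apUpcC_empty_right]
      rcases Finset.subset_singleton_iff.1 hM with rfl | rfl
      · rw [apUpc_empty]
      · exact apUpc_edge hq hst (hmono (Finset.empty_subset _) le_rfl)
    · rw [apUpcC_eq_zero_of_mem q (Finset.mem_singleton_self _) hst]
  | @series E₁ E₂ a m b h₁ h₂ hd hV ha hb ih₁ ih₂ =>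
    intro M C hM hC h hmono
    have g₁ : ∀ e ∈ (↑E₁ : Set (Sym2 V)), ∀ z ∈ e, z ∈ {z : V | ∃ e ∈ E₁, z ∈ e} := fun e he z hz => ⟨e, he, hz⟩
    have g₂ : ∀ e ∈ (↑E₂ : Set (Sym2 V)), ∀ z ∈ e, z ∈ {z : V | ∃ e ∈ E₂, z ∈ e} := fun e he z hz => ⟨e, he, hz⟩
    have gS : {z : V | ∃ e ∈ E₁, z ∈ e} ∩ {z : V | ∃ e ∈ E₂, z ∈ e} ⊆ ({m} : Set V) :=
      fun z hz => hV z hz.1 hz.2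
    have gaV₂ : a ∉ {z : V | ∃ e ∈ E₂, z ∈ e} := fun ⟨e, he, hae⟩ => ha e he hae
    have gbV₁ : b ∉ {z : V | ∃ e ∈ E₁, z ∈ e} := fun ⟨e, he, hbe⟩ => hb e he hbe
    have gam : a ≠ m := by
      obtain ⟨e, he, hme⟩ := h₂.left_mem
      intro ham; exact ha e he (ham ▸ hme)
    have gbm : b ≠ m := by
      obtain ⟨e, he, hme⟩ := h₁.right_mem
      intro hbm; exact hb e he (hbm ▸ hme)
    have gab : a ≠ b := by
      obtain ⟨e, he, hae⟩ := h₁.left_mem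
      intro hab; exact hb e he (hab ▸ hae)
    have hMeq : M = M ∩ E₁ ∪ M ∩ E₂ := by
      rw [← Finset.inter_union_distrib_left, Finset.inter_eq_left.2 hM]
    have hCeq : C = C ∩ E₁ ∪ C ∩ E₂ := by
      rw [← Finset.inter_union_distrib_left, Finset.inter_eq_left.2 hC]
    rw [hMeq] at hmono ⊢
    rw [hCeq]
    exact apUpcC_series_nonneg hq hd g₁ g₂ gS gaV₂ gbV₁ gam gbm gab Finset.inter_subset_right Finset.inter_subset_right
      Finset.inter_subset_right Finset.inter_subset_right (ih₁ _ _ Finset.inter_subset_right Finset.inter_subset_right)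
      (ih₂ _ _ Finset.inter_subset_right Finset.inter_subset_right) hmono
  | @parallel E₁ E₂ s t h₁ h₂ hd hV ih₁ ih₂ =>
    intro M C hM hC h hmono
    have g₁ : ∀ e ∈ (↑E₁ : Set (Sym2 V)), ∀ z ∈ e, z ∈ {z : V | ∃ e ∈ E₁, z ∈ e} := fun e he z hz => ⟨e, he, hz⟩
    have g₂ : ∀ e ∈ (↑E₂ : Set (Sym2 V)), ∀ z ∈ e, z ∈ {z : V | ∃ e ∈ E₂, z ∈ e} := fun e he z hz => ⟨e, he, hz⟩
    have gS : {z : V | ∃ e ∈ E₁, z ∈ e} ∩ {z : V | ∃ e ∈ E₂, z ∈ e} ⊆ ({s, t} : Set V) := by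
      intro z hz
      rcases hV z hz.1 hz.2 with h | h
      · exact Or.inl h
      · exact Or.inr h
    have gst : s ≠ t := h₁.ne
    have hMeq : M = M ∩ E₁ ∪ M ∩ E₂ := by
      rw [← Finset.inter_union_distrib_left, Finset.inter_eq_left.2 hM]
    have hCeq : C = C ∩ E₁ ∪ C ∩ E₂ := by
      rw [← Finset.inter_union_distrib_left, Finset.inter_eq_left.2 hC]
    rw [hMeq] at hmono ⊢
    rw [hCeq]
    exact apUpcC_parallel_nonneg hq hd g₁ g₂ gS gst Finset.inter_subset_right Finset.inter_subset_right
      Finset.inter_subset_right Finset.inter_subset_right (ih₁ _ _ Finset.inter_subset_right Finset.inter_subset_right)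
      (ih₂ _ _ Finset.inter_subset_right Finset.inter_subset_right) hmono

end Main

/-! ### All coefficients of `Z² Cov_{φ_{z,q}}(ω_x, g)` on series–parallel graphs -/

section NegDep

variable {s t : V}

omit [Fintype V] in
/-- Symmetry of the exponent under `γ ↦ E \ γ`. [folklore] -/
theorem apExpC_compl {E C γ : Finset (Sym2 V)} (h : γ ⊆ E) : apExpC E C (E \ γ) = apExpC E C γ := by
  unfold apExpC
  rw [Finset.sdiff_sdiff_eq_self h, add_comm]

omit [Fintype V] in
/-- The flipped functional: `∑_γ q^{…} (c(γ∪C) - c(γᶜ∪C)) h(γᶜ) = - apUpcC q E C s t h`. [folklore] -/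
theorem sum_apSignC_compl (q : ℝ) (E C : Finset (Sym2 V)) (s t : V) (h : Finset (Sym2 V) → ℝ) :
    ∑ γ ∈ E.powerset, q ^ apExpC E C γ * ((apConn (γ ∪ C) s t - apConn (E \ γ ∪ C) s t) * h (E \ γ)) =
      - apUpcC q E C s t h := by
  unfold apUpcC
  rw [sum_powerset_flip E (fun γ => q ^ apExpC E C γ * ((apConn (γ ∪ C) s t - apConn (E \ γ ∪ C) s t) * h (E \ γ))),
    ← Finset.sum_neg_distrib]
  refine Finset.sum_congr rfl fun γ hγ => ?_
  have hγE := Finset.mem_powerset.1 hγ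
  simp only [Finset.sdiff_sdiff_eq_self hγE, apExpC_compl hγE]
  ring

/-- **The one-edge antipodal covariance form with a contracted set is the up-correlation functional**: for `x = st ∉ E ∪ C` and `g`
not reading `x`, `q · apPsiC q (E ∪ {x}) C 1_x g = 2(q - 1) · apUpcC q E C s t (γ ↦ g(γ ∪ C))`.
[cite: Grimmett2006, §1.4 eq. (1.20) (p. 15); Thm. (3.1)(a)] -/
theorem apPsiC_edge_eq (q : ℝ) {E C : Finset (Sym2 V)} (hst : s(s, t) ∉ E) (hstC : s(s, t) ∉ C) {g : Finset (Sym2 V) → ℝ}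
    (hg : ∀ A : Finset (Sym2 V), g (insert s(s, t) A) = g A) :
    q * apPsiC q (insert s(s, t) E) C (fun A => if s(s, t) ∈ A then 1 else 0) g =
      2 * (q - 1) * apUpcC q E C s t (fun γ => g (γ ∪ C)) := by
  unfold apPsiC
  rw [Finset.sum_powerset_insert hst, ← Finset.sum_add_distrib, Finset.mul_sum]
  have hR : 2 * (q - 1) * apUpcC q E C s t (fun γ => g (γ ∪ C)) =
      ∑ γ ∈ E.powerset, (q - 1) * (q ^ apExpC E C γ *
        ((apConn (γ ∪ C) s t - apConn (E \ γ ∪ C) s t) * (g (γ ∪ C) - g (E \ γ ∪ C)))) := by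
    have h1 : ∑ γ ∈ E.powerset, (q - 1) * (q ^ apExpC E C γ *
        ((apConn (γ ∪ C) s t - apConn (E \ γ ∪ C) s t) * (g (γ ∪ C) - g (E \ γ ∪ C)))) =
        (q - 1) * apUpcC q E C s t (fun γ => g (γ ∪ C)) -
          (q - 1) * ∑ γ ∈ E.powerset, q ^ apExpC E C γ *
            ((apConn (γ ∪ C) s t - apConn (E \ γ ∪ C) s t) * g (E \ γ ∪ C)) := by
      unfold apUpcC
      rw [Finset.mul_sum, Finset.mul_sum, ← Finset.sum_sub_distrib]
      exact Finset.sum_congr rfl fun γ _ => by ring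
    rw [h1, sum_apSignC_compl q E C s t (fun γ => g (γ ∪ C))]
    ring
  rw [hR]
  refine Finset.sum_congr rfl fun γ hγ => ?_
  have hγE : γ ⊆ E := Finset.mem_powerset.1 hγ
  have hxγ : s(s, t) ∉ γ := fun h => hst (hγE h)
  have hxγC : s(s, t) ∉ γ ∪ C := by
    rw [Finset.mem_union, not_or]; exact ⟨hxγ, hstC⟩
  have hxcC : s(s, t) ∉ E \ γ ∪ C := by
    rw [Finset.mem_union, not_or]; exact ⟨fun h => hst (Finset.sdiff_subset h), hstC⟩
  have e1 : insert s(s, t) E \ γ = insert s(s, t) (E \ γ) := Finset.insert_sdiff_of_notMem E hxγ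
  have e2 : insert s(s, t) E \ insert s(s, t) γ = E \ γ := by
    rw [Finset.insert_sdiff_insert, Finset.sdiff_insert_of_notMem hst]
  rw [e1, e2, Finset.insert_union, Finset.insert_union]
  simp only [hxγC, hxcC, Finset.mem_insert_self, if_true, if_false, hg]
  have k1 := clusterCount_union_pair_add (↑(γ ∪ C) : BondConfig V) s t
  have k2 := clusterCount_union_pair_add (↑(E \ γ ∪ C) : BondConfig V) s t
  have c1 : (↑(insert s(s, t) (γ ∪ C)) : BondConfig V) = ↑(γ ∪ C) ∪ {s(s, t)} := by
    rw [Finset.coe_insert, Set.insert_eq, Set.union_comm]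
  have c2 : (↑(insert s(s, t) (E \ γ ∪ C)) : BondConfig V) = ↑(E \ γ ∪ C) ∪ {s(s, t)} := by
    rw [Finset.coe_insert, Set.insert_eq, Set.union_comm]
  have ex1 : apExpC (insert s(s, t) E) C (insert s(s, t) γ) + 1 =
      apExpC E C γ + (if (openGraph (↑(γ ∪ C) : BondConfig V)).Reachable s t then 1 else 0) := by
    unfold apExpC
    rw [e2, Finset.insert_union, c1]
    split_ifs at k1 with hr
    · rw [if_pos hr]; omega
    · rw [if_neg hr]; omega
  have ex2 : apExpC (insert s(s, t) E) C γ + 1 =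
      apExpC E C γ + (if (openGraph (↑(E \ γ ∪ C) : BondConfig V)).Reachable s t then 1 else 0) := by
    unfold apExpC
    rw [e1, Finset.insert_union, c2]
    split_ifs at k2 with hr
    · rw [if_pos hr]; omega
    · rw [if_neg hr]; omega
  have hq1 : q * q ^ apExpC (insert s(s, t) E) C (insert s(s, t) γ) =
      q ^ apExpC E C γ * q ^ (if (openGraph (↑(γ ∪ C) : BondConfig V)).Reachable s t then 1 else 0) := by
    rw [← pow_succ', ex1, pow_add]
  have hq2 : q * q ^ apExpC (insert s(s, t) E) C γ =
      q ^ apExpC E C γ * q ^ (if (openGraph (↑(E \ γ ∪ C) : BondConfig V)).Reachable s t then 1 else 0) := by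
    rw [← pow_succ', ex2, pow_add]
  unfold apConn
  calc q * (q ^ apExpC (insert s(s, t) E) C γ * ((0 - 1) * (g (γ ∪ C) - g (E \ γ ∪ C))) +
          q ^ apExpC (insert s(s, t) E) C (insert s(s, t) γ) * ((1 - 0) * (g (γ ∪ C) - g (E \ γ ∪ C))))
      = (q * q ^ apExpC (insert s(s, t) E) C (insert s(s, t) γ) - q * q ^ apExpC (insert s(s, t) E) C γ) *
          (g (γ ∪ C) - g (E \ γ ∪ C)) := by ring
    _ = _ := by
      rw [hq1, hq2]
      by_cases a₁ : (openGraph (↑(γ ∪ C) : BondConfig V)).Reachable s t <;>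
      by_cases b₁ : (openGraph (↑(E \ γ ∪ C) : BondConfig V)).Reachable s t <;>
      simp only [a₁, b₁, if_true, if_false, pow_one, pow_zero] <;> ring

/-- **ALL coefficients of `Z² Cov_{φ_{z,q}}(ω_x, g)` are `≤ 0` on series–parallel graphs (`0 < q ≤ 1`).**  If `E` is a two-terminal
series–parallel network between `s` and `t`, `M, C ⊆ E`, and `x = st ∉ M ∪ C`, then for every `g` monotone (on the subsets of `M ∪ C`) and
not reading `x`: `apPsiC q (M ∪ {x}) C 1_x g ≤ 0` — twice the coefficient of `z^{2·1_C + 1_{M ∪ {x}}}` in `Z_H(z)² Cov_{φ_{z,q}}(ω_x, g)` for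
every `H ⊇ M ∪ C ∪ {x}` whose other edges are deleted; with `H` the completed network `E ∪ {x}` (every 2-connected series–parallel graph
presented from one of its edges) these are ALL the coefficients: gen 10's Conjecture C_∞ at `|supp f| = 1`, the coefficientwise form of
single-edge negative dependence, false for `K₄`. [cite: Grimmett2006, §3.9 (pp. 63–64)] [cite: Wagner2006, Thm. 5.8(d), §5.3] -/
theorem apPsiC_edge_nonpos_of_isTTSP {q : ℝ} (hq0 : 0 < q) (hq1 : q ≤ 1) {E M C : Finset (Sym2 V)} (hE : IsTTSP E s t)
    (hM : M ⊆ E) (hC : C ⊆ E) (hst : s(s, t) ∉ M) (hstC : s(s, t) ∉ C) {g : Finset (Sym2 V) → ℝ}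
    (hg : ∀ A : Finset (Sym2 V), g (insert s(s, t) A) = g A)
    (hmono : ∀ ⦃A B : Finset (Sym2 V)⦄, A ⊆ B → B ⊆ M ∪ C → g A ≤ g B) :
    apPsiC q (insert s(s, t) M) C (fun A => if s(s, t) ∈ A then 1 else 0) g ≤ 0 := by
  have key := apPsiC_edge_eq q hst hstC hg
  have hU := apUpcC_nonneg_of_isTTSP hq0 hE M C hM hC (fun γ => g (γ ∪ C)) fun A B hAB hB =>
    hmono (Finset.union_subset_union hAB le_rfl) (Finset.union_subset_union hB le_rfl)
  have h2 : q * apPsiC q (insert s(s, t) M) C (fun A => if s(s, t) ∈ A then 1 else 0) g ≤ 0 := by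
    rw [key]; nlinarith
  nlinarith

/-- **… and the reversal for `q ≥ 1`**: all coefficients are `≥ 0`. [cite: Grimmett2006, Thm. (3.8); §3.9 (pp. 63–64)] -/
theorem apPsiC_edge_nonneg_of_isTTSP_of_one_le {q : ℝ} (hq1 : 1 ≤ q) {E M C : Finset (Sym2 V)} (hE : IsTTSP E s t)
    (hM : M ⊆ E) (hC : C ⊆ E) (hst : s(s, t) ∉ M) (hstC : s(s, t) ∉ C) {g : Finset (Sym2 V) → ℝ}
    (hg : ∀ A : Finset (Sym2 V), g (insert s(s, t) A) = g A)
    (hmono : ∀ ⦃A B : Finset (Sym2 V)⦄, A ⊆ B → B ⊆ M ∪ C → g A ≤ g B) :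
    0 ≤ apPsiC q (insert s(s, t) M) C (fun A => if s(s, t) ∈ A then 1 else 0) g := by
  have hq0 : 0 < q := by linarith
  have key := apPsiC_edge_eq q hst hstC hg
  have hU := apUpcC_nonneg_of_isTTSP hq0 hE M C hM hC (fun γ => g (γ ∪ C)) fun A B hAB hB =>
    hmono (Finset.union_subset_union hAB le_rfl) (Finset.union_subset_union hB le_rfl)
  have h2 : 0 ≤ q * apPsiC q (insert s(s, t) M) C (fun A => if s(s, t) ∈ A then 1 else 0) g := by
    rw [key]; nlinarith
  nlinarith

omit [Fintype V] in
/-- **Two free edges reduce to one** (with a contracted set): for `x, y ∈ E` off `C`,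
`apPsiC(1_x 1_y, g) = ½ (apPsiC(1_x, g) + apPsiC(1_y, g))`. [folklore] -/
theorem apPsiC_two_edges_eq (q : ℝ) {E C : Finset (Sym2 V)} {x y : Sym2 V} (hx : x ∈ E) (hy : y ∈ E) (hxC : x ∉ C) (hyC : y ∉ C)
    (g : Finset (Sym2 V) → ℝ) :
    apPsiC q E C (fun A => if x ∈ A ∧ y ∈ A then 1 else 0) g =
      (apPsiC q E C (fun A => if x ∈ A then 1 else 0) g + apPsiC q E C (fun A => if y ∈ A then 1 else 0) g) / 2 := by
  unfold apPsiC
  rw [← Finset.sum_add_distrib, Finset.sum_div]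
  refine Finset.sum_congr rfl fun γ hγ => ?_
  have hx1 : x ∈ γ ∪ C ↔ x ∈ γ := by rw [Finset.mem_union]; exact ⟨fun h => h.resolve_right hxC, Or.inl⟩
  have hy1 : y ∈ γ ∪ C ↔ y ∈ γ := by rw [Finset.mem_union]; exact ⟨fun h => h.resolve_right hyC, Or.inl⟩
  have hxc : x ∈ E \ γ ∪ C ↔ x ∉ γ := by
    rw [Finset.mem_union, Finset.mem_sdiff]
    exact ⟨fun h => h.elim (fun h => h.2) fun h => absurd h hxC, fun h => Or.inl ⟨hx, h⟩⟩
  have hyc : y ∈ E \ γ ∪ C ↔ y ∉ γ := by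
    rw [Finset.mem_union, Finset.mem_sdiff]
    exact ⟨fun h => h.elim (fun h => h.2) fun h => absurd h hyC, fun h => Or.inl ⟨hy, h⟩⟩
  simp only [hx1, hy1, hxc, hyc]
  by_cases a : x ∈ γ <;> by_cases b : y ∈ γ <;>
  simp only [a, b, and_self, and_true, and_false, if_true, if_false, not_true_eq_false, not_false_eq_true] <;> ring

/-- **All coefficients of `Z² Cov_{φ_{z,q}}(ω_x ω_y, g)` are `≤ 0`** (`0 < q ≤ 1`): `E` TTSP between `s, t`, `C ⊆ E`, `x = st ∉ E`,
`y = uv ∈ E \ C`, `g` monotone reading neither `x` nor `y` ⇒ `apPsiC q ((E \ C) ∪ {x}) C (1_x 1_y) g ≤ 0`; the `y`-form comes from re-rooting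
`E ∪ {x}` at `y` (`FK.IsTTSP.reroot`). [cite: Grimmett2006, §3.9 (pp. 63–64)] [cite: Wagner2006, Thm. 5.8(d), §5.3] -/
theorem apPsiC_two_edges_nonpos_of_isTTSP {q : ℝ} (hq0 : 0 < q) (hq1 : q ≤ 1) {E C : Finset (Sym2 V)} (hE : IsTTSP E s t)
    (hC : C ⊆ E) (hst : s(s, t) ∉ E) {u v : V} (huv : s(u, v) ∈ E) (huvC : s(u, v) ∉ C) {g : Finset (Sym2 V) → ℝ}
    (hgx : ∀ A : Finset (Sym2 V), g (insert s(s, t) A) = g A) (hgy : ∀ A : Finset (Sym2 V), g (insert s(u, v) A) = g A)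
    (hmono : ∀ ⦃A B : Finset (Sym2 V)⦄, A ⊆ B → g A ≤ g B) :
    apPsiC q (insert s(s, t) (E \ C)) C (fun A => if s(s, t) ∈ A ∧ s(u, v) ∈ A then 1 else 0) g ≤ 0 := by
  have hstC : s(s, t) ∉ C := fun h => hst (hC h)
  have hyM : s(u, v) ∈ insert s(s, t) (E \ C) := Finset.mem_insert_of_mem (Finset.mem_sdiff.2 ⟨huv, huvC⟩)
  rw [apPsiC_two_edges_eq q (Finset.mem_insert_self _ _) hyM hstC huvC]
  have hx : apPsiC q (insert s(s, t) (E \ C)) C (fun A => if s(s, t) ∈ A then 1 else 0) g ≤ 0 :=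
    apPsiC_edge_nonpos_of_isTTSP hq0 hq1 hE Finset.sdiff_subset hC (fun h => hst (Finset.sdiff_subset h)) hstC hgx
      fun A B hAB _ => hmono hAB
  -- the `y`-form: re-root `E ∪ {st}` at `y = uv`
  have hR : IsTTSP (E ∪ {s(s, t)}) u v :=
    hE.reroot (IsTTSP.edge hE.ne) (Finset.disjoint_singleton_right.2 hst) (fun z _ hz => by
      obtain ⟨e, he, hze⟩ := hz
      rw [Finset.mem_singleton] at he; subst he
      exact Sym2.mem_iff.1 hze) huv
  set M := (insert s(s, t) (E \ C)).erase s(u, v) with hM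
  have hMsub : M ⊆ E ∪ {s(s, t)} := by
    intro e he
    rcases Finset.mem_insert.1 (Finset.mem_of_mem_erase he) with h | h
    · exact Finset.mem_union_right _ (Finset.mem_singleton.2 h)
    · exact Finset.mem_union_left _ (Finset.sdiff_subset h)
  have hCsub : C ⊆ E ∪ {s(s, t)} := fun e he => Finset.mem_union_left _ (hC he)
  have hyMn : s(u, v) ∉ M := Finset.notMem_erase _ _
  have hins : insert s(u, v) M = insert s(s, t) (E \ C) := Finset.insert_erase hyM
  have hy : apPsiC q (insert s(s, t) (E \ C)) C (fun A => if s(u, v) ∈ A then 1 else 0) g ≤ 0 := by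
    rw [← hins]
    exact apPsiC_edge_nonpos_of_isTTSP hq0 hq1 hR hMsub hCsub hyMn huvC hgy fun A B hAB _ => hmono hAB
  linarith

end NegDep

end FK

end Summit.CriticalPhenomena.PercolationContinuityZ3.Theorems

end
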